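import Summits.MatrixMultiplication.OmegaCensus.SmallFormats.MatMul225FramePlaneCap
import HarnessLib

/-!
# ω-census family (a): the TYPE-F COUNT of an Alekseev frame — `#{t : p_t = 0} + 2m ≤ 2|J|` (any field, any length)

Cell `pub-omega` (unit `pub-omega-tensor`, gen 37), topic `Summits/MatrixMultiplication/OmegaCensus` (sub-folder `SmallFormats`). Framing
(verbatim): lottery ticket; floor = certified bounds/negative ranges. HONEST FRAMING: the reusable core of this generation's frame plane cap,
isolated for successors (no new consequence): for EVERY bilinear computation of `⟨m,2,2⟩` and every Alekseev frame `F`, the indices with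
`p_t = 0` (first X-row of the transposed `⟨2,2,m⟩` marginal zero) lie in `F.R1`, hence `#{t : p_t = 0} + 2m ≤ |R1| + 2m ≤ 2|J|`
(`Frame.colCount`). With Lemma 6 (`|J| ≤ d − 2m`) this is Alekseev–Nazarov's cap `2d − 6m`; with `|J| ≤ m+1` at `d = 3m+2` (p703299) it is
the cap `2` of `MatMul225FramePlaneCap`; any future bound `|J| ≤ m + j` at length `d` gives the rows/cols cap `2j` by the two lemmas below.
Nothing here is a bound on `ω`.
-/

namespace Summit.MatrixMultiplication.OmegaCensus.SmallFormats.FramePlaneCap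

open Finset Matrix Module
open Literature.Computability.AlgebraicComplexity
open Summit.MatrixMultiplication.OmegaCensus.RankOnePlaneCapGeneral

variable {k : Type*} [Field k] {m : ℕ} {ι : Type*} [Fintype ι] [DecidableEq ι]

/-- **Type-F indices are rank-one indices of every frame**: if `p_t = 0` then `t ∈ F.R1`. -/
theorem mem_R1_of_pvec_eq_zero {β : BilinComp (mulBilin k m 2 2) ι} (F : Alekseev2015.Frame β) {t : ι}
    (hp : Alekseev2015.pvec β t = 0) : t ∈ F.R1 := by
  have htI : t ∉ F.I := fun h => F.pvec_ne_zero h hp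
  have hD : Alekseev2015.D1 β t = 0 := by ext x; simp [hp]
  rw [F.mem_R1]
  refine ⟨F.mem_J.2 htI, ?_⟩
  rw [F.N2_eq_D2_of_D1_eq_zero htI hD]
  exact Alekseev2015.rankLEOne_smulRight _ _

/-- **The type-F count of a frame** (any field, any length): a set `s` of indices with `p_t = 0` satisfies `|s| + 2m ≤ 2|J|`. -/
theorem card_add_two_mul_le_two_mul_card_J {β : BilinComp (mulBilin k m 2 2) ι} (F : Alekseev2015.Frame β)
    (s : Finset ι) (hs : ∀ t ∈ s, Alekseev2015.pvec β t = 0) : s.card + 2 * m ≤ 2 * F.J.card := by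
  have hsub : s ⊆ F.R1 := fun t ht => mem_R1_of_pvec_eq_zero F (hs t ht)
  have h1 := card_le_card hsub
  have hcol := F.colCount
  have hsd : (F.J \ F.R1).card = F.J.card - F.R1.card := card_sdiff_of_subset F.R1_subset
  have hR1le : F.R1.card ≤ F.J.card := card_le_card F.R1_subset
  omega

/-- **The rows clause from a `|J|` bound, census orientation** (any field): if every frame of every length-`d` computation of `⟨n,2,2⟩` has
`|J| ≤ n + j`, then in every length-`d` computation of `⟨2,2,n⟩` at most `2j` X-forms have coefficient matrix with zero first row. -/
theorem card_le_of_frame_bound {n d j : ℕ} (β : BilinComp (mulBilin k 2 2 n) ι) (hι : Fintype.card ι = d)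
    (hJ : ∀ (β' : BilinComp (mulBilin k n 2 2) ι) (F : Alekseev2015.Frame β'), Fintype.card ι = d → F.J.card ≤ n + j)
    (s : Finset ι) (hs : ∀ t ∈ s, ∀ c, xMarginal β t 0 c = 0) : s.card ≤ 2 * j := by
  classical
  obtain ⟨β', hβ'⟩ := exists_trComp β
  obtain ⟨F⟩ := Alekseev2015.exists_frame β'
  have h1 := card_add_two_mul_le_two_mul_card_J F s fun t ht => by
    funext c; rw [hβ', hs t ht c]; rfl
  have h2 := hJ β' F hι
  omega

end Summit.MatrixMultiplication.OmegaCensus.SmallFormats.FramePlaneCap
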